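import Summits.QuantumFields.BalabanUV.Beta.GAN24.ScalarZerothLetterTorus
import Summits.QuantumFields.BalabanUV.Beta.GAN24.ScalarSupLettersCubicHolds

/-!
# G-an2-4 ∕ (CONV-C), road P2, route R2-S1 — THE ALL-SITES ONE-STEP SUP LAW OF THE SCALAR SOFT MINIMISER ON CUBIC TORI,
# UNCONDITIONAL: `|(M′v)(x′) − (Mv)(par x′)| ≤ C(d,a′)·((R−1)∕(RN))·(2 + log(RN) + log N)·|v|_∞` for every `N, R, N₀ ≥ 1`, every
# `a′ > 0` — the requester's END `SoftMinimiserOneStepSup.norm_Msoft_succ_sub_stair_le_of_letters` with its four letters supplied BY NAME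
# by the G-an2-4 swarm's `ScalarSupLettersCubicHolds.scalarLetters_cubic`; and the unit-lattice corollary for `S′ − S = Q′(M′ − J·M)`

Unit `b2b-balaban-gan24-p2` (gen 29), BINDER row G-an2-4 ∕ (CONV-C), road P2; crux team (2).  The two INTERFACE REQUEST lines of this seat
(`HOME/INBOX.md` 2026-08-21T08:13Z: (B5-1112-LOG, VECTOR) and (SCALAR-LETTERS for `Gps`, CUBIC)) were answered by the swarm within the
hour: leaf-01 gen 55 (`ScalarFreeResolvent*`, `ScalarSup110G.gps_block_row_sum_le` = (L0) for EVERY torus), leaf-06 gen 35 (the (α) chain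
`FlatResolventPieces`∕`FlatResolventStep`∕`ScalarFlatLift`∕`ScalarFlatDictionary`∕`ScalarFlatResolvent`∕`ScalarSupLettersCubic(Holds)`),
leaf-03 gen 48 (`SliceFlat*`), leaf-04 gen 47 (`SndDiffRowSumTransport`, `Entry112SupLogCubic`, `ScalarSupReductions`).  THIS FILE is the
20-line junction announced in the request:
 * (the zeroth letter (L0) on EVERY torus in road P2's currencies is `GAN24/ScalarZerothLetterTorus`: `rowDecay_Gps`, `sup_Gps`, `sup_Msoft`);
 * **`norm_Msoft_succ_sub_stair_le_cubic`** — `∃ C > 0` (function of `d, a′`) with, for every `N R N₀ ≥ 1`, every `v` with `|v| ≤ V` and every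
   fine site `x′` of the `η∕R`-lattice over the cubic unit torus `Π_{μ<d+1} ℤ∕N₀`:
   `‖(Msoft (R*N) _ a′ *ᵥ v) x′ − (Msoft N _ a′ *ᵥ v) (par N R _ x′)‖ ≤ C * ((R − 1) ∕ (R * N)) * (2 + log (R*N) + log N) * V`
   (`C = (d+1)·a′·Cst²`; the logs are the second-order letters' `1 + log n`);
 * **`norm_Savg_succ_sub_mulVec_le_cubic`** — the same bound for `|((S_{RN} − S_N)v)(y)|` on the unit torus (`HardMinimiserOneStepSup.Savg`,
   `S′ − S = Q′(M′ − J·M)` and `|Q′f| ≤ |f|_∞`).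
READING.  With `N = L^k`, `R = L`: the scalar soft minimiser's one-step sup defect at ALL fine sites is `≤ C′·k·L^{−k}·|v|_∞` — summable in
`k`; the unit-lattice operator `S_k = a′Q′G′_kQ′*` (the scalar «averaged propagator» ∕ soft effective Laplacian complement) is sup-norm Cauchy
in `k` at the same rate.  The HARD minimiser's law (`HardMinimiserOneStepSup.norm_Mhard_succ_sub_stair_le_of_letters`) still displays the two
unit-lattice bounds `σ, σ′` on `S⁻¹` (not supplied here); the KERNEL-currency laws (`MinimiserOneStepDecay`) need the letters in LOCALISED
(`RowDecay`) form — the suppliers' chains carry them internally (per-cube rows with decay); their torus-indexed export is the next interface item.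
HONEST SCOPE.  Junction only (`obtain` + `calc`); scalar (0-form) prototype, `U = 1`, CUBIC unit tori, every `a′ > 0`; constants existential in
`(d, a′)` (the suppliers'); nothing of Bałaban's asserted ([B5] (1.73) p. 30, (1.115) p. 36 are TEXT LOCATIONS).  NOT (CONV-C) as typed (a
statement about `(G_k, H_k, C^{(k)})` with kernel decay), NEVER «G-an2-4 closed», NOT NE2, NOT D1, NOT BetaPertH, NOT continuum, NOT Clay; not in
print — our proof.  HONEST DEPENDENCY: continuum YM on T⁴ ⇐ BetaPertH ∧ nine spine estimates (0/9 proved); BetaPertH ⇐ (D1) ∧ (D4) ∧ CAP+tail;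
G-an2-4 gates asym, D1 and NE2/3/4.
-/

noncomputable section

open scoped BigOperators ComplexConjugate Matrix

namespace Summit.QuantumFields.BalabanUV.Beta.GAN24.SoftMinimiserOneStepCubic

open Literature.MathematicalPhysics.QuantumFieldTheory.Balaban1983to89
open B5Prop11Plancherel (Tor fine)
open B5Action121 (sdiff)
open B5Block118 (QsOp)
open Summit.QuantumFields.BalabanUV.T4Continuum.BalabanAveragedTowerModes (par)
open Summit.QuantumFields.BalabanUV.T4Continuum.ScalarAveragedPropagator (Gps)
open Summit.QuantumFields.BalabanUV.Beta.GAN24.StaircaseLaplacianDefect (stair stair_mulVec)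
open Summit.QuantumFields.BalabanUV.Beta.GAN24.SoftMinimiserOneStepSup (Msoft norm_Msoft_succ_sub_stair_le_of_letters)
open Summit.QuantumFields.BalabanUV.Beta.GAN24.HardMinimiserOneStepSup (Savg Savg_succ_sub norm_QsOp_mulVec_le)
open Summit.QuantumFields.BalabanUV.Beta.GAN24.ScalarSupLettersCubicHolds (scalarLetters_cubic)

variable (d : ℕ)

/-- **THE ALL-SITES ONE-STEP SUP LAW OF THE SCALAR SOFT MINIMISER ON CUBIC TORI, UNCONDITIONAL**: for every `a′ > 0` there is `C > 0` (a function of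
`d, a′`) such that for all `N, R, N₀ ≥ 1`, all unit-lattice sources `v` with `|v| ≤ V` and every fine site `x′`,
`‖(M′v)(x′) − (Mv)(par x′)‖ ≤ C·((R−1)∕(RN))·(2 + log(RN) + log N)·V`. [folklore] -/
theorem norm_Msoft_succ_sub_stair_le_cubic {a' : ℝ} (ha' : 0 < a') :
    ∃ C : ℝ, 0 < C ∧ ∀ (N R N₀ : ℕ) [NeZero N] [NeZero R] [NeZero N₀]
      (v : Tor (fun _ : Fin (d + 1) => N₀) → ℂ) (V : ℝ), (∀ y, ‖v y‖ ≤ V) →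
        ∀ x : Tor (fine (R * N) (fun _ : Fin (d + 1) => N₀)),
          ‖(Msoft (R * N) (fun _ : Fin (d + 1) => N₀) a' *ᵥ v) x
              - (Msoft N (fun _ : Fin (d + 1) => N₀) a' *ᵥ v) (par N R (fun _ : Fin (d + 1) => N₀) x)‖
            ≤ C * (((R : ℝ) - 1) / ((R : ℝ) * N)) * (2 + Real.log ((R * N : ℕ) : ℝ) + Real.log (N : ℝ)) * V := by
  obtain ⟨Cst, hCst, h⟩ := scalarLetters_cubic d ha'
  refine ⟨((d : ℝ) + 1) * a' * Cst ^ 2, by positivity, ?_⟩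
  intro N R N₀ _ _ _ v V hv x
  have hN : 1 ≤ N := Nat.one_le_iff_ne_zero.mpr (NeZero.ne N)
  have hRN : 1 ≤ R * N := Nat.one_le_iff_ne_zero.mpr (NeZero.ne (R * N))
  have key := norm_Msoft_succ_sub_stair_le_of_letters N R (fun _ : Fin (d + 1) => N₀) ha'
    (B₁ := Cst * (1 + Real.log ((R * N : ℕ) : ℝ))) (B₂ := Cst) (C₁ := Cst) (C₂ := Cst * (1 + Real.log (N : ℝ))) (V := V)
    (fun μ g b hg x => ((h (R * N) N₀ hRN μ μ g b hg x).2.1))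
    (fun μ g b hg x => ((h (R * N) N₀ hRN μ μ g b hg x).1))
    (fun μ f b hf z => ((h N N₀ hN μ μ f b hf z).2.2.1))
    (fun μ f b hf z => ((h N N₀ hN μ μ f b hf z).2.2.2))
    v hv x
  calc _ ≤ _ := key
    _ = ((d : ℝ) + 1) * a' * Cst ^ 2 * (((R : ℝ) - 1) / ((R : ℝ) * N)) *
          (2 + Real.log ((R * N : ℕ) : ℝ) + Real.log (N : ℝ)) * V := by
        push_cast; ring

/-- **THE UNIT-LATTICE COROLLARY, UNCONDITIONAL**: the same bound for the one-step difference of `S_n = a′Q′G′_nQ′*` applied to `v`: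
`|((S_{RN} − S_N)v)(y)| ≤ C·((R−1)∕(RN))·(2 + log(RN) + log N)·V` (`S′ − S = Q′(M′ − J·M)`, `|Q′f| ≤ |f|_∞`). [folklore] -/
theorem norm_Savg_succ_sub_mulVec_le_cubic {a' : ℝ} (ha' : 0 < a') :
    ∃ C : ℝ, 0 < C ∧ ∀ (N R N₀ : ℕ) [NeZero N] [NeZero R] [NeZero N₀]
      (v : Tor (fun _ : Fin (d + 1) => N₀) → ℂ) (V : ℝ), (∀ y, ‖v y‖ ≤ V) →
        ∀ y : Tor (fun _ : Fin (d + 1) => N₀),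
          ‖((Savg (R * N) (fun _ : Fin (d + 1) => N₀) a' - Savg N (fun _ : Fin (d + 1) => N₀) a') *ᵥ v) y‖
            ≤ C * (((R : ℝ) - 1) / ((R : ℝ) * N)) * (2 + Real.log ((R * N : ℕ) : ℝ) + Real.log (N : ℝ)) * V := by
  obtain ⟨C, hC, h⟩ := norm_Msoft_succ_sub_stair_le_cubic d ha'
  refine ⟨C, hC, fun N R N₀ _ _ _ v V hv y => ?_⟩
  rw [Savg_succ_sub, ← Matrix.mulVec_mulVec]
  refine norm_QsOp_mulVec_le (R * N) (fun _ : Fin (d + 1) => N₀) _ (fun x => ?_) y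
  rw [Matrix.sub_mulVec, Pi.sub_apply, ← Matrix.mulVec_mulVec, stair_mulVec]
  exact h N R N₀ v V hv x

end Summit.QuantumFields.BalabanUV.Beta.GAN24.SoftMinimiserOneStepCubic

end
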